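import Literature.Computability.QuantumComplexity.ExpansionNat
import Literature.Computability.QuantumComplexity.CompilerBudget
import HarnessLib

/-!
# Typed polynomial time for the reduction's expansion and implementation

Topic `Literature/Computability/QuantumComplexity`, sequel of `ExpansionNat.lean` and
`CompilerBudget.lean` (Aharonov–Arad 2011, Thm. 3.1): the numeral-record maps of the reduction as
typed `FP` maps (`CodeFP`): `adjSwapRecs`, `chainRecs`, list reversal `rawReverse`, `cpRecs`
(with the wire count as unary budget), `expandRec`, the parsing of placed-gate codes
(`gatePayload_codeFP`, `gateTag_codeFP`), `expandGateRec`, `expandGatesRec`; the implementation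
`letterGensNat`, `wordGensNat`, `symsOfWord`, `Gadget.expand`, `gadgetGensNat`, `implRec`; and
**`reductionWordNat_codeFP`**: the numeral braid word of the reduction is a typed polynomial-time
function of (unary wire count, gate list).

## References

* D. Aharonov, I. Arad, New J. Phys. 13 (2011) 035019, Thm. 3.1, §3 [AharonovArad2011].
* S. Arora, B. Barak, *Computational Complexity*, CUP 2009, §1.2–1.3 [AroraBarak2009].
-/

noncomputable section

namespace Literature.Computability.QuantumComplexity

open Literature.Computability.Complexity Literature.Computability.Complexity.CodeFP Cryptography ExactCompiler _root_.Computability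

/-! ### Codes -/

/-- The code of a record. [folklore] -/
abbrev recE : PrimRec → List Bool := pairE natE (pairE natE natE)

/-- The code of a numeral crossing. [folklore] -/
abbrev genE : ℕ × Bool → List Bool := pairE natE bitE

/-! ### Reversal -/

/-- **List reversal is typed polynomial time** (a fold consing onto the accumulator; local copy of the
tree's `AJLCore.rawReverse`, kept private to keep the import closure small). [folklore] -/
private theorem rawReverse {α : Type} (e : α → List Bool) : CodeFP (rawE e) (rawE e) List.reverse := by
  have hstep : CodeFP (pairE e (rawE e)) (rawE e) (fun t => t.1 :: t.2) := rawCons e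
  refine ((CodeFP.foldl₀ (step := fun (a : α) (acc : List α) => a :: acc) (b₀ := ([] : List α)) hstep Polynomial.X
    fun l₁ l₂ => ?_).congr fun l => ?_)
  · rw [Polynomial.eval_X, List.foldl_flip_cons_eq_append', List.append_nil, length_rawE, length_rawE, List.map_reverse,
      List.sum_reverse, List.map_append, List.sum_append]
    omega
  · rw [List.foldl_flip_cons_eq_append', List.append_nil]

/-! ### Chains and controlled phases -/

/-- The records of an adjacent swap from a template. [folklore] -/
theorem adjSwapRecs_eq_map (b : ℕ) : adjSwapRecs b =
    ([(0, 1), (2, 0), (0, 1), (0, 0), (2, 0), (0, 0), (0, 1), (2, 0), (0, 1)] : List (ℕ × ℕ)).map fun ko => (ko.1, b + ko.2, 0) := rfl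

/-- **Adjacent swaps are typed polynomial time.** [folklore] -/
theorem adjSwapRecs_codeFP : CodeFP natE (rawE recE) adjSwapRecs := by
  have hitem : CodeFP (pairE natE (pairE natE natE)) recE (fun s => (s.2.1, s.1 + s.2.2, 0)) :=
    ((snd _ _).fst').pair ((natAdd.comp ((fst _ _).pair (snd _ _).snd')).pair (const _ 0))
  have hargs : CodeFP natE (pairE natE (rawE (pairE natE natE))) (fun b => (b, ([(0, 1), (2, 0), (0, 1), (0, 0), (2, 0), (0, 0), (0, 1), (2, 0), (0, 1)] : List (ℕ × ℕ)))) :=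
    (CodeFP.id _).pair (const _ _)
  exact ((CodeFP.map hitem).comp hargs).congr fun b => by rw [adjSwapRecs_eq_map]

/-- Chains in closed form. [folklore] -/
theorem chainRecs_eq (lo : ℕ) : ∀ d : ℕ, chainRecs lo d = ((List.range d).map fun k => adjSwapRecs (lo + 1 + k)).flatten
  | 0 => rfl
  | d + 1 => by rw [chainRecs, chainRecs_eq lo d, List.range_succ, List.map_append, List.flatten_append, List.map_singleton, List.flatten_singleton]

/-- **Chains are typed polynomial time** (`d` in unary). [folklore] -/
theorem chainRecs_codeFP : CodeFP (pairE natE unE) (rawE recE) (fun p => chainRecs p.1 p.2) := by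
  have hitem : CodeFP (pairE natE natE) (rawE recE) (fun s => adjSwapRecs (s.1 + 1 + s.2)) :=
    adjSwapRecs_codeFP.comp (natAdd.comp ((natAdd.comp ((fst _ _).pair (const _ 1))).pair (snd _ _)))
  have hargs : CodeFP (pairE natE unE) (pairE natE (rawE natE)) (fun p => (p.1, List.range p.2)) := (fst _ _).pair (urange.comp (snd _ _))
  exact (((CodeFP.flatten recE).comp ((CodeFP.map hitem).comp hargs)).congr fun p => by rw [chainRecs_eq])

/-- The controlled phase on `i < j`, with `j - i - 1` capped by a unary budget. [folklore] -/
def cpRecsLtB (bud : ℕ) (i j u : ℕ) : List PrimRec :=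
  (chainRecs i (min (j - i - 1) bud)).reverse ++ [(2, i, u)] ++ chainRecs i (min (j - i - 1) bud)

/-- Below the budget it is `cpRecsLt`. [folklore] -/
theorem cpRecsLtB_eq {bud i j u : ℕ} (h : j ≤ bud) : cpRecsLtB bud i j u = cpRecsLt i j u := by
  rw [cpRecsLtB, cpRecsLt, Nat.min_eq_left (by omega)]

/-- `cpRecsLtB` is typed polynomial time (layout `(bud, (i, (j, u)))`). [folklore] -/
theorem cpRecsLtB_codeFP : CodeFP (pairE unE (pairE natE (pairE natE natE))) (rawE recE) (fun t => cpRecsLtB t.1 t.2.1 t.2.2.1 t.2.2.2) := by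
  have hi : CodeFP (pairE unE (pairE natE (pairE natE natE))) natE (fun t => t.2.1) := (snd _ _).fst'
  have hj : CodeFP (pairE unE (pairE natE (pairE natE natE))) natE (fun t => t.2.2.1) := (snd _ _).snd'.fst'
  have hu : CodeFP (pairE unE (pairE natE (pairE natE natE))) natE (fun t => t.2.2.2) := (snd _ _).snd'.snd'
  have hd : CodeFP (pairE unE (pairE natE (pairE natE natE))) unE (fun t => min (t.2.2.1 - t.2.1 - 1) t.1) := by
    exact (unOfNatMin.comp ((fst _ _).pair (natSub.comp ((natSub.comp (hj.pair hi)).pair (const _ 1)))) :)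
  have hch : CodeFP (pairE unE (pairE natE (pairE natE natE))) (rawE recE) (fun t => chainRecs t.2.1 (min (t.2.2.1 - t.2.1 - 1) t.1)) :=
    chainRecs_codeFP.comp (hi.pair hd)
  have hmid : CodeFP (pairE unE (pairE natE (pairE natE natE))) (rawE recE) (fun t => [((2 : ℕ), t.2.1, t.2.2.2)]) :=
    (rawSingleton recE).comp ((const _ 2).pair (hi.pair hu))
  have happ : ∀ {u v : _ → List PrimRec}, CodeFP (pairE unE (pairE natE (pairE natE natE))) (rawE recE) u →
      CodeFP (pairE unE (pairE natE (pairE natE natE))) (rawE recE) v → CodeFP (pairE unE (pairE natE (pairE natE natE))) (rawE recE) (fun t => u t ++ v t) :=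
    fun hu hv => by exact ((rawAppend recE).comp (hu.pair hv) :)
  exact (happ (happ ((rawReverse recE).comp hch) hmid) hch).congr fun _ => rfl

/-- The symmetric version with a budget. [folklore] -/
def cpRecsB (bud i j u : ℕ) : List PrimRec := if i < j then cpRecsLtB bud i j u else cpRecsLtB bud j i u

/-- Below the budget it is `cpRecs`. [folklore] -/
theorem cpRecsB_eq {bud i j u : ℕ} (hi : i ≤ bud) (hj : j ≤ bud) : cpRecsB bud i j u = cpRecs i j u := by
  unfold cpRecsB cpRecs; rw [cpRecsLtB_eq hj, cpRecsLtB_eq hi]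

/-- `cpRecsB` is typed polynomial time. [folklore] -/
theorem cpRecsB_codeFP : CodeFP (pairE unE (pairE natE (pairE natE natE))) (rawE recE) (fun t => cpRecsB t.1 t.2.1 t.2.2.1 t.2.2.2) := by
  have hi : CodeFP (pairE unE (pairE natE (pairE natE natE))) natE (fun t => t.2.1) := (snd _ _).fst'
  have hj : CodeFP (pairE unE (pairE natE (pairE natE natE))) natE (fun t => t.2.2.1) := (snd _ _).snd'.fst'
  have hu : CodeFP (pairE unE (pairE natE (pairE natE natE))) natE (fun t => t.2.2.2) := (snd _ _).snd'.snd'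
  have htest : CodeFP (pairE unE (pairE natE (pairE natE natE))) bitE (fun t => decide (t.2.1 < t.2.2.1)) := by exact (natLt.comp (hi.pair hj) :)
  have hswap : CodeFP (pairE unE (pairE natE (pairE natE natE))) (pairE unE (pairE natE (pairE natE natE))) (fun t => (t.1, (t.2.2.1, (t.2.1, t.2.2.2)))) :=
    (fst _ _).pair (hj.pair (hi.pair hu))
  have h2 : CodeFP (pairE unE (pairE natE (pairE natE natE))) (rawE recE) (fun t => cpRecsLtB t.1 t.2.2.1 t.2.1 t.2.2.2) :=
    (cpRecsLtB_codeFP.comp hswap).congr fun _ => rfl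
  exact (htest.ite cpRecsLtB_codeFP h2).congr fun t => by unfold cpRecsB; simp only [decide_eq_true_eq]

/-! ### The expansion of a gate from its symbol and wires -/

/-- The expansion with a budget (layout `(bud, (sym, wires))`). [folklore] -/
def expandRecB (bud : ℕ) (sym : ℕ) (ws : List ℕ) : List PrimRec :=
  if sym = 0 then [(0, ws.getD 0 0, 0)]
  else if sym = 1 then [(1, ws.getD 0 0, 0)]
  else if sym = 2 then cpRecsB bud (ws.getD 0 0) (ws.getD 1 0) 0
  else cpRecsB bud (ws.getD 1 0) (ws.getD 2 0) 1 ++ ([(0, ws.getD 1 0, 0)] ++ cpRecsB bud (ws.getD 0 0) (ws.getD 1 0) 0 ++ [(0, ws.getD 1 0, 0)]) ++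
    cpRecsB bud (ws.getD 1 0) (ws.getD 2 0) 2 ++ ([(0, ws.getD 1 0, 0)] ++ cpRecsB bud (ws.getD 0 0) (ws.getD 1 0) 0 ++ [(0, ws.getD 1 0, 0)]) ++
    cpRecsB bud (ws.getD 0 0) (ws.getD 2 0) 1

/-- Below the budget it is `expandRec`. [folklore] -/
theorem expandRecB_eq {bud sym : ℕ} {ws : List ℕ} (h : ∀ w ∈ ws, w ≤ bud) : expandRecB bud sym ws = expandRec sym ws := by
  have hg : ∀ k, ws.getD k 0 ≤ bud := by
    intro k
    rw [List.getD_eq_getElem?_getD]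
    cases hk : ws[k]? with
    | none => simp
    | some w => simpa using h w (List.mem_of_getElem? hk)
  unfold expandRecB expandRec
  simp only [cpRecsB_eq (hg _) (hg _)]

/-- `expandRecB` is typed polynomial time (layout `(bud, (sym, wires))`, wires raw). [folklore] -/
theorem expandRecB_codeFP : CodeFP (pairE unE (pairE natE (rawE natE))) (rawE recE) (fun t => expandRecB t.1 t.2.1 t.2.2) := by
  have hbud : CodeFP (pairE unE (pairE natE (rawE natE))) unE (fun t => t.1) := fst _ _
  have hsym : CodeFP (pairE unE (pairE natE (rawE natE))) natE (fun t => t.2.1) := (snd _ _).fst'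
  have hws : CodeFP (pairE unE (pairE natE (rawE natE))) (rawE natE) (fun t => t.2.2) := (snd _ _).snd'
  have hget : ∀ k : ℕ, CodeFP (pairE unE (pairE natE (rawE natE))) natE (fun t => t.2.2.getD k 0) := fun k => by
    exact ((rawGetOr natE).comp (hws.pair ((const _ k).pair (const _ 0))) :)
  have heq : ∀ c : ℕ, CodeFP (pairE unE (pairE natE (rawE natE))) bitE (fun t => decide (t.2.1 = c)) := fun c => by
    exact (natEq.comp (hsym.pair (const _ c)) :)
  have hsing : ∀ (k : ℕ) (i : ℕ), CodeFP (pairE unE (pairE natE (rawE natE))) (rawE recE) (fun t => [((k : ℕ), t.2.2.getD i 0, (0 : ℕ))]) := fun k i =>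
    (rawSingleton recE).comp ((const _ k).pair ((hget i).pair (const _ 0)))
  have hcp : ∀ (i j u : ℕ), CodeFP (pairE unE (pairE natE (rawE natE))) (rawE recE) (fun t => cpRecsB t.1 (t.2.2.getD i 0) (t.2.2.getD j 0) u) := by
    intro i j u
    have hargs : CodeFP (pairE unE (pairE natE (rawE natE))) (pairE unE (pairE natE (pairE natE natE))) (fun t => (t.1, (t.2.2.getD i 0, (t.2.2.getD j 0, u)))) :=
      hbud.pair ((hget i).pair ((hget j).pair (const _ u)))
    exact (cpRecsB_codeFP.comp hargs).congr fun _ => rfl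
  have happ : ∀ {u v : _ → List PrimRec}, CodeFP (pairE unE (pairE natE (rawE natE))) (rawE recE) u →
      CodeFP (pairE unE (pairE natE (rawE natE))) (rawE recE) v → CodeFP (pairE unE (pairE natE (rawE natE))) (rawE recE) (fun t => u t ++ v t) :=
    fun hu hv => by exact ((rawAppend recE).comp (hu.pair hv) :)
  have hH := hsing 0 0
  have hZ := hsing 1 0
  have hCZ := hcp 0 1 0
  have hblock := happ (happ (hsing 0 1) (hcp 0 1 0)) (hsing 0 1)
  have hCCZ := happ (happ (happ (happ (hcp 1 2 1) hblock) (hcp 1 2 2)) hblock) (hcp 0 2 1)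
  exact ((heq 0).ite hH ((heq 1).ite hZ ((heq 2).ite hCZ hCCZ))).congr fun t => by
    unfold expandRecB; simp only [decide_eq_true_eq]

/-! ### Parsing placed-gate codes -/

/-- A placed gate on any number of wires (the machine does not see the wire count in the gate code). [folklore] -/
abbrev GItem : Type := Σ n : ℕ, QGate hSign n

/-- The code of a placed gate (the library's `QGate.encode`). [folklore] -/
def gateE (g : GItem) : List Bool := QGate.encode g.2

/-- The tag of a placed gate: `true` for oracle queries. [folklore] -/
def gateTag : GItem → Bool
  | ⟨_, QGate.gate _ _⟩ => false
  | ⟨_, QGate.oracle _ _⟩ => true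

/-- The payload of a placed gate: symbol numeral (or query width) and wires. [folklore] -/
def gatePayload : GItem → ℕ × List ℕ
  | ⟨_, QGate.gate g e⟩ => (Encodable.encode g, wiresOf e)
  | ⟨_, QGate.oracle k e⟩ => (k, wiresOf e)

/-- The library code of a placed gate is the tag bit followed by the typed code of the payload. [folklore] -/
theorem gateE_eq (g : GItem) : gateE g = gateTag g :: pairE natE (listE natE) (gatePayload g) := by
  rcases g with ⟨n, ⟨g, e⟩ | ⟨k, e⟩⟩
  · change false :: boolPair (encodeNat (Encodable.encode g)) (encodingListNatBool.encode (List.ofFn fun i => (e i : ℕ))) = _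
    rw [pairE_apply, show (encodingListNatBool.encode : List ℕ → List Bool) = listE natE from listE_eq encodingNatBool]; rfl
  · change true :: boolPair (encodeNat k) (encodingListNatBool.encode (List.ofFn fun i => (e i : ℕ))) = _
    rw [pairE_apply, show (encodingListNatBool.encode : List ℕ → List Bool) = listE natE from listE_eq encodingNatBool]; rfl

/-- **The tag is typed polynomial time.** [folklore] -/
theorem gateTag_codeFP : CodeFP gateE bitE gateTag := by
  have hs : CodeFP gateE strE (fun g => gateE g) := CodeFP.transparent fun _ => rfl
  have h : CodeFP gateE strE (fun g => (gateE g).take 1) := strTake.comp ((const _ 1).pair hs)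
  exact h.recodeOut fun g => by rw [gateE_eq]; rfl

/-- **The payload is typed polynomial time.** [folklore] -/
theorem gatePayload_codeFP : CodeFP gateE (pairE natE (listE natE)) gatePayload := by
  have hs : CodeFP gateE strE (fun g => gateE g) := CodeFP.transparent fun _ => rfl
  have h : CodeFP gateE strE (fun g => (gateE g).drop 1) := strDrop.comp ((const _ 1).pair hs)
  exact h.recodeOut fun g => by rw [gateE_eq]; rfl

/-- The expansion of a placed gate with a budget. [folklore] -/
def expandGateRecB (bud : ℕ) (g : GItem) : List PrimRec :=
  if gateTag g then [] else expandRecB bud (gatePayload g).1 (gatePayload g).2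

/-- The wires of a placed gate are below `n`. [folklore] -/
theorem wiresOf_lt {n k : ℕ} (e : Fin k ↪ Fin n) : ∀ w ∈ wiresOf e, w < n := by
  intro w hw
  rw [wiresOf, List.mem_ofFn] at hw
  obtain ⟨i, rfl⟩ := hw
  exact (e i).isLt

/-- Below the budget it is `expandGateRec`. [folklore] -/
theorem expandGateRecB_eq {n bud : ℕ} (hb : n ≤ bud) (g : QGate hSign n) : expandGateRecB bud ⟨n, g⟩ = expandGateRec g := by
  rcases g with ⟨g, e⟩ | ⟨k, e⟩
  · simp only [expandGateRecB, gateTag, expandGateRec, gatePayload]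
    exact expandRecB_eq fun w hw => ((wiresOf_lt e w hw).le.trans hb)
  · rfl

/-- **The expansion of a placed gate is typed polynomial time** (layout `(bud, g)`). [folklore] -/
theorem expandGateRecB_codeFP : CodeFP (pairE unE gateE) (rawE recE) (fun t => expandGateRecB t.1 t.2) := by
  have htag : CodeFP (pairE unE gateE) bitE (fun t => gateTag t.2) := gateTag_codeFP.comp (snd _ _)
  have hpay : CodeFP (pairE unE gateE) (pairE natE (listE natE)) (fun t => gatePayload t.2) := gatePayload_codeFP.comp (snd _ _)
  have hargs : CodeFP (pairE unE gateE) (pairE unE (pairE natE (rawE natE))) (fun t => (t.1, ((gatePayload t.2).1, (gatePayload t.2).2))) :=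
    (fst _ _).pair (hpay.fst'.pair ((rawOfList natE).comp hpay.snd'))
  have hexp : CodeFP (pairE unE gateE) (rawE recE) (fun t => expandRecB t.1 (gatePayload t.2).1 (gatePayload t.2).2) :=
    (expandRecB_codeFP.comp hargs).congr fun _ => rfl
  exact (htag.ite (const _ []) hexp).congr fun t => by unfold expandGateRecB; rfl

/-- The expansion of a gate list with a budget. [folklore] -/
def expandGatesRecB (bud : ℕ) (gs : List GItem) : List PrimRec := (gs.reverse.map (expandGateRecB bud)).flatten

/-- The items of a gate list. [folklore] -/
def items {n : ℕ} (gs : List (QGate hSign n)) : List GItem := gs.map (Sigma.mk n)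

/-- The code of the items is the code of the gates. [folklore] -/
theorem rawE_items {n : ℕ} (gs : List (QGate hSign n)) : rawE gateE (items gs) = rawE QGate.encode gs := by
  rw [items, rawE, rawE, List.map_map]; rfl

/-- Below the budget it is `expandGatesRec`. [folklore] -/
theorem expandGatesRecB_eq {n bud : ℕ} (hb : n ≤ bud) (gs : List (QGate hSign n)) : expandGatesRecB bud (items gs) = expandGatesRec gs := by
  rw [expandGatesRecB, expandGatesRec, items, List.map_reverse, List.map_map]
  congr 1
  rw [← List.map_reverse]
  exact List.map_congr_left fun g _ => expandGateRecB_eq hb g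

/-- **The expansion of a gate list is typed polynomial time** (layout `(bud, gs)`). [cite: AharonovArad2011, §3.2] -/
theorem expandGatesRecB_codeFP : CodeFP (pairE unE (rawE gateE)) (rawE recE) (fun t => expandGatesRecB t.1 t.2) := by
  have hargs : CodeFP (pairE unE (rawE gateE)) (pairE unE (rawE gateE)) (fun t => (t.1, t.2.reverse)) :=
    (fst _ _).pair ((rawReverse _).comp (snd _ _))
  exact (((CodeFP.flatten recE).comp ((CodeFP.map expandGateRecB_codeFP).comp hargs)).congr fun _ => rfl)

/-! ### The implementation of records -/

/-- The code of the five compiled words. [folklore] -/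
abbrev w5E : List Letter × List Letter × List Letter × List Letter × List Letter → List Bool :=
  pairE (rawE letterE) (pairE (rawE letterE) (pairE (rawE letterE) (pairE (rawE letterE) (rawE letterE))))

section Letters

variable {α : Type} {eα : α → List Bool}

/-- Equality with a fixed letter is typed polynomial time. [folklore] -/
theorem letterIs {g : α → Letter} (hg : CodeFP eα letterE g) (γ : Letter) : CodeFP eα bitE (fun a => decide (g a = γ)) := by
  exact ((CodeFP.eq letterE_injective).comp (hg.pair (const _ γ)) :)

/-- A four-way case distinction on a computed letter. [folklore] -/
theorem letterCases {β : Type} {eβ : β → List Bool} {g : α → Letter} (hg : CodeFP eα letterE g) {fx fy fxi fyi : α → β}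
    (hx : CodeFP eα eβ fx) (hy : CodeFP eα eβ fy) (hxi : CodeFP eα eβ fxi) (hyi : CodeFP eα eβ fyi) :
    CodeFP eα eβ (fun a => match g a with | Letter.x => fx a | Letter.y => fy a | Letter.xi => fxi a | Letter.yi => fyi a) :=
  ((letterIs hg Letter.x).ite hx ((letterIs hg Letter.y).ite hy ((letterIs hg Letter.xi).ite hxi hyi))).congr fun a => by
    cases h : g a <;> simp

end Letters

/-- `letterGensNat` as a case distinction. [folklore] -/
theorem letterGensNat_eq (a : ℕ) (γ : Letter) : letterGensNat a γ =
    (match γ with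
      | Letter.x => [(4 * a + 0, true), (4 * a + 1, false)]
      | Letter.y => [(4 * a + 0, false), (4 * a + 1, true)]
      | Letter.xi => [(4 * a + 1, true), (4 * a + 0, false)]
      | Letter.yi => [(4 * a + 1, false), (4 * a + 0, true)]) := by
  cases γ <;> rfl

/-- **The crossings of a letter are typed polynomial time** (layout `(a, γ)`). [folklore] -/
theorem letterGensNat_codeFP : CodeFP (pairE natE letterE) (rawE genE) (fun t => letterGensNat t.1 t.2) := by
  have h4a : CodeFP (pairE natE letterE) natE (fun t => 4 * t.1) := by exact (natMul.comp ((const _ 4).pair (fst _ _)) :)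
  have hk : ∀ r : ℕ, CodeFP (pairE natE letterE) natE (fun t => 4 * t.1 + r) := fun r => by exact (natAdd.comp (h4a.pair (const _ r)) :)
  have hpairL : ∀ (r : ℕ) (b : Bool) (r' : ℕ) (b' : Bool), CodeFP (pairE natE letterE) (rawE genE) (fun t => [(4 * t.1 + r, b), (4 * t.1 + r', b')]) := by
    intro r b r' b'
    have h2 : CodeFP (pairE natE letterE) (rawE genE) (fun t => [(4 * t.1 + r', b')]) := (rawSingleton genE).comp ((hk r').pair (const _ b'))
    exact ((rawCons genE).comp (((hk r).pair (const _ b)).pair h2)).congr fun _ => rfl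
  exact (letterCases (snd _ _) (hpairL 0 true 1 false) (hpairL 0 false 1 true) (hpairL 1 true 0 false) (hpairL 1 false 0 true)).congr fun t => by
    rw [letterGensNat_eq]

/-- **The crossings of a word on a block are typed polynomial time** (layout `(a, w)`). [folklore] -/
theorem wordGensNat_codeFP : CodeFP (pairE natE (rawE letterE)) (rawE genE) (fun t => wordGensNat t.1 t.2) :=
  ((CodeFP.flatten genE).comp (CodeFP.map letterGensNat_codeFP)).congr fun t => by rw [wordGensNat, flatMap_eq_flatten_map]

/-- The numeral of a gadget symbol. [folklore] -/
def Gadget.Sym.toNat : Gadget.Sym → ℕ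
  | Gadget.Sym.M => 0
  | Gadget.Sym.Minv => 1
  | Gadget.Sym.M' => 2
  | Gadget.Sym.M'inv => 3

/-- The code of a gadget symbol. [folklore] -/
def symE (s : Gadget.Sym) : List Bool := natE s.toNat

/-- The symbols of a letter, pointwise constant. [folklore] -/
theorem symsOf_codeFP : CodeFP letterE (rawE symE) symsOf :=
  (letterCases (CodeFP.id _) (const _ (symsOf Letter.x)) (const _ (symsOf Letter.y)) (const _ (symsOf Letter.xi)) (const _ (symsOf Letter.yi))).congr
    fun γ => by cases γ <;> rfl

/-- **The symbols of a word are typed polynomial time.** [folklore] -/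
theorem symsOfWord_codeFP : CodeFP (rawE letterE) (rawE symE) symsOfWord :=
  ((CodeFP.flatten symE).comp ((map₀ symsOf_codeFP).comp (rawReverse letterE))).congr fun _ => rfl

/-- The crossings of a gadget symbol, as numerals. [folklore] -/
def symWordNat (s : Gadget.Sym) : List (ℕ × Bool) := (Gadget.Sym.word s).map fun l => ((l.1 : ℕ), l.2)

/-- Equality with a fixed symbol is typed polynomial time. [folklore] -/
theorem symIs {α : Type} {eα : α → List Bool} {g : α → Gadget.Sym} (hg : CodeFP eα symE g) (s : Gadget.Sym) : CodeFP eα bitE (fun a => decide (g a = s)) := by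
  have hinj : Function.Injective symE := by
    intro a b h; cases a <;> cases b <;> first | rfl | exact absurd (natE_injective h) (by decide)
  exact ((CodeFP.eq hinj).comp (hg.pair (const _ s)) :)

/-- The crossings of a symbol, pointwise constant. [folklore] -/
theorem symWordNat_codeFP : CodeFP symE (rawE genE) symWordNat := by
  have h1 : CodeFP symE bitE (fun s => decide (s = Gadget.Sym.M)) := symIs (CodeFP.id _) Gadget.Sym.M
  have h2 : CodeFP symE bitE (fun s => decide (s = Gadget.Sym.Minv)) := symIs (CodeFP.id _) Gadget.Sym.Minv
  have h3 : CodeFP symE bitE (fun s => decide (s = Gadget.Sym.M')) := symIs (CodeFP.id _) Gadget.Sym.M'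
  have c1 : CodeFP symE (rawE genE) (fun _ => symWordNat Gadget.Sym.M) := const _ _
  have c2 : CodeFP symE (rawE genE) (fun _ => symWordNat Gadget.Sym.Minv) := const _ _
  have c3 : CodeFP symE (rawE genE) (fun _ => symWordNat Gadget.Sym.M') := const _ _
  have c4 : CodeFP symE (rawE genE) (fun _ => symWordNat Gadget.Sym.M'inv) := const _ _
  exact (h1.ite c1 (h2.ite c2 (h3.ite c3 c4))).congr fun s => by cases s <;> simp

/-- The gadget crossings as numerals, from the symbol words. [folklore] -/
theorem gadgetGensNat_eq (a : ℕ) (g : List Gadget.Sym) :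
    gadgetGensNat a g = ((g.map symWordNat).flatten.reverse).map fun l => (4 * a + l.1, l.2) := by
  rw [gadgetGensNat, Gadget.expand, List.map_reverse, List.map_reverse]
  congr 1
  rw [flatMap_eq_flatten_map, List.map_flatten, List.map_flatten, List.map_map, List.map_map]
  congr 1
  refine List.map_congr_left fun s _ => ?_
  simp [symWordNat, Function.comp, List.map_map]

/-- **The gadget crossings are typed polynomial time** (layout `(a, g)`). [folklore] -/
theorem gadgetGensNat_codeFP : CodeFP (pairE natE (rawE symE)) (rawE genE) (fun t => gadgetGensNat t.1 t.2) := by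
  have htab : CodeFP (pairE natE (rawE symE)) (rawE genE) (fun t => ((t.2.map symWordNat).flatten).reverse) :=
    (rawReverse genE).comp ((CodeFP.flatten genE).comp ((map₀ symWordNat_codeFP).comp (snd _ _)))
  have hitem : CodeFP (pairE natE genE) genE (fun s => (4 * s.1 + s.2.1, s.2.2)) := by
    exact ((natAdd.comp ((natMul.comp ((const _ 4).pair (fst _ _))).pair (snd _ _).fst')).pair (snd _ _).snd' :)
  exact ((CodeFP.map hitem).comp ((fst _ _).pair htab)).congr fun t => by rw [gadgetGensNat_eq]

/-- **The implementation of a record is typed polynomial time** (layout `(words, r)`). [cite: AharonovArad2011, §3.3] -/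
theorem implRec_codeFP : CodeFP (pairE w5E recE) (rawE genE) (fun t => implRec t.1.1 t.1.2.1 t.1.2.2.1 t.1.2.2.2.1 t.1.2.2.2.2 t.2) := by
  have ha : CodeFP (pairE w5E recE) natE (fun t => t.2.2.1) := (snd _ _).snd'.fst'
  have hk : CodeFP (pairE w5E recE) natE (fun t => t.2.1) := (snd _ _).fst'
  have hu : CodeFP (pairE w5E recE) natE (fun t => t.2.2.2) := (snd _ _).snd'.snd'
  have hw1 : CodeFP (pairE w5E recE) (rawE letterE) (fun t => t.1.1) := (fst _ _).fst'
  have hw2 : CodeFP (pairE w5E recE) (rawE letterE) (fun t => t.1.2.1) := (fst _ _).snd'.fst'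
  have hw3 : CodeFP (pairE w5E recE) (rawE letterE) (fun t => t.1.2.2.1) := (fst _ _).snd'.snd'.fst'
  have hw4 : CodeFP (pairE w5E recE) (rawE letterE) (fun t => t.1.2.2.2.1) := (fst _ _).snd'.snd'.snd'.fst'
  have hw5 : CodeFP (pairE w5E recE) (rawE letterE) (fun t => t.1.2.2.2.2) := (fst _ _).snd'.snd'.snd'.snd'
  have hwg : ∀ {w : _ → List Letter}, CodeFP (pairE w5E recE) (rawE letterE) w → CodeFP (pairE w5E recE) (rawE genE) (fun t => wordGensNat t.2.2.1 (w t)) :=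
    fun hw => by exact ((wordGensNat_codeFP.comp (ha.pair hw)).congr fun _ => rfl)
  have hgg : ∀ {w : _ → List Letter}, CodeFP (pairE w5E recE) (rawE letterE) w → CodeFP (pairE w5E recE) (rawE genE) (fun t => gadgetGensNat t.2.2.1 (symsOfWord (w t))) :=
    fun hw => by exact ((gadgetGensNat_codeFP.comp (ha.pair (symsOfWord_codeFP.comp hw))).congr fun _ => rfl)
  have hk0 : CodeFP (pairE w5E recE) bitE (fun t => decide (t.2.1 = 0)) := by exact (natEq.comp (hk.pair (const _ 0)) :)
  have hk1 : CodeFP (pairE w5E recE) bitE (fun t => decide (t.2.1 = 1)) := by exact (natEq.comp (hk.pair (const _ 1)) :)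
  have hu0 : CodeFP (pairE w5E recE) bitE (fun t => decide (t.2.2.2 = 0)) := by exact (natEq.comp (hu.pair (const _ 0)) :)
  have hu1 : CodeFP (pairE w5E recE) bitE (fun t => decide (t.2.2.2 = 1)) := by exact (natEq.comp (hu.pair (const _ 1)) :)
  exact ((hk0.ite (hwg hw1) (hk1.ite (hwg hw2) (hu0.ite (hgg hw3) (hu1.ite (hgg hw4) (hgg hw5)))))).congr fun t => by
    unfold implRec; simp only [decide_eq_true_eq]

/-! ### The braid word of the reduction -/

/-- **The five compiled words** for `m` primitives: `iH`, `iZ` on the one-qubit instance, `-1`,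
`diag(i,-i)`, `diag(-i,i)` on the gadget instance. [cite: AharonovArad2011, §3.3] -/
def words5 (P : CompilerParams) (m : ℕ) : List Letter × List Letter × List Letter × List Letter × List Letter :=
  (wordOf scoreH (netOf E₁ P.l₁) (wordCand E₁ P.seed₁) m, (wordOf scoreZ (netOf E₁ P.l₁) (wordCand E₁ P.seed₁) m,
    (wordOf scoreCZ (netOf E₂ P.l₂) (wordCand E₂ P.seed₂) m, (wordOf scoreZ (netOf E₂ P.l₂) (wordCand E₂ P.seed₂) m,
      wordOf scoreZ' (netOf E₂ P.l₂) (wordCand E₂ P.seed₂) m))))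

/-- **The five compiled words are typed polynomial-time functions of `1ᵐ`** (good parameters). [cite: AharonovArad2011, §3.3] -/
theorem words5_codeFP {P : CompilerParams} (hP : P.Good) : CodeFP unE w5E (words5 P) :=
  (wordOf_codeFP E₁ scoreH_codeFP hP.net₁.1 (wf_wordCand E₁ invLaw₁ _)).pair
    ((wordOf_codeFP E₁ scoreZ_codeFP hP.net₁.1 (wf_wordCand E₁ invLaw₁ _)).pair
      ((wordOf_codeFP E₂ scoreCZ_codeFP hP.net₂.1 (wf_wordCand E₂ invLaw₂ _)).pair
        ((wordOf_codeFP E₂ scoreZ_codeFP hP.net₂.1 (wf_wordCand E₂ invLaw₂ _)).pair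
          (wordOf_codeFP E₂ scoreZ'_codeFP hP.net₂.1 (wf_wordCand E₂ invLaw₂ _)))))

/-- The compiled words of `EncodedCompilation` are `wordOf`. [folklore] -/
theorem word₁_eq_wordOf (P : CompilerParams) (sc : Matrix (Fin 2) (Fin 2) K5 → ZPhiS) (m : ℕ) :
    word₁ P sc (lOf m) = wordOf sc (netOf E₁ P.l₁) (wordCand E₁ P.seed₁) m := rfl

/-- See `word₁_eq_wordOf`. [folklore] -/
theorem word₂_eq_wordOf (P : CompilerParams) (sc : Matrix (Fin 2) (Fin 2) K5 → ZPhiS) (m : ℕ) :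
    word₂ P sc (lOf m) = wordOf sc (netOf E₂ P.l₂) (wordCand E₂ P.seed₂) m := rfl

/-- **The braid word of the reduction with a budget**, on items. [cite: AharonovArad2011, Thm. 3.1] -/
def reductionWordNatB (P : CompilerParams) (bud : ℕ) (gs : List GItem) : List (ℕ × Bool) :=
  let recs := expandGatesRecB bud gs
  let W := words5 P recs.length
  recs.flatMap (implRec W.1 W.2.1 W.2.2.1 W.2.2.2.1 W.2.2.2.2)

/-- Below the budget it is `reductionWordNat`. [folklore] -/
theorem reductionWordNatB_eq (P : CompilerParams) {n bud : ℕ} (hb : n ≤ bud) (gs : List (QGate hSign n)) :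
    reductionWordNatB P bud (items gs) = reductionWordNat P gs := by
  simp only [reductionWordNatB, reductionWordNat, expandGatesRecB_eq hb, words5, word₁_eq_wordOf, word₂_eq_wordOf]

/-- **The braid word of the reduction is a typed polynomial-time function of `(1ⁿ, gates)`.** [cite: AharonovArad2011, Thm. 3.1] -/
theorem reductionWordNatB_codeFP {P : CompilerParams} (hP : P.Good) :
    CodeFP (pairE unE (rawE gateE)) (rawE genE) (fun t => reductionWordNatB P t.1 t.2) := by
  have hrecs : CodeFP (pairE unE (rawE gateE)) (rawE recE) (fun t => expandGatesRecB t.1 t.2) := expandGatesRecB_codeFP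
  have hW : CodeFP (pairE unE (rawE gateE)) w5E (fun t => words5 P (expandGatesRecB t.1 t.2).length) := (words5_codeFP hP).comp ((ulength recE).comp hrecs)
  have hargs : CodeFP (pairE unE (rawE gateE)) (pairE w5E (rawE recE)) (fun t => (words5 P (expandGatesRecB t.1 t.2).length, expandGatesRecB t.1 t.2)) := hW.pair hrecs
  refine (((CodeFP.flatten genE).comp ((CodeFP.map implRec_codeFP).comp hargs)).congr fun t => ?_)
  simp only [reductionWordNatB, flatMap_eq_flatten_map]

end Literature.Computability.QuantumComplexity

end
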